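import Literature.Barriers.RiemannHypothesis.FeketePolyaPositivityChowla
import HarnessLib

/-!
# Chowla's induced-character evasion at `d = −163` needs a modulus `≥ 6.5 · 10¹²`: the Liouville block `1 … 40`

Barrier-audit sibling (D-0021, audit of 2026-08-16) of
`Literature/Barriers/RiemannHypothesis/FeketePolyaPositivity.lean` (catalogue entry
`FeketePolyaPositivity`, whose `evasions_known` line offers Chowla's induced-character conjecture
as the published way around Heilbronn's obstruction) and of `FeketePolyaPositivityChowla.lean`
(the parity-corrected conjecture `ChowlaInducedCharacterConjectureOdd`: every odd primitive
quadratic `ψ` mod `q` has an induced character `ψ↑m`, `q ∣ m`, with `S_1(N, ψ↑m) ≥ 0` for all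
`N ≥ 1`). Everything here is PROVED (kernel-checked, `decide`; no `native_decide`).

## The result

`chowla_inducing_modulus_chi163`: if `163 ∣ m` and the character `χ_{−163}↑m` induced by
`χ_{−163} = (·/163)` mod `m` has `S_1(N, χ_{−163}↑m) ≥ 0` for all `N ≥ 1` (indeed for all
`N ≤ 40`), then `m ≥ 6 538 271 978 238 = 163 · (2·3·7·11·13·17·19·23·29·31)`. Consequently the
witness that `ChowlaInducedCharacterConjectureOdd` must produce for `ψ = χ_{−163}` has modulus
`≥ 6.5 · 10^{12}` (`chowlaOdd_witness_chi163_ge`): at the barrier's own character the evasion is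
a statement about character sums of period `> 10^{13}`, and it is computationally UNVERIFIED —
"However (see [CDH]), nobody has been able to prove this hypothesis in the difficult special case
that `χ` is the odd character mod `163` … In fact, it is because he could not check this
hypothesis in that case that J. B. Rosser developed in [Ros] a completely different technique to
prove that `L(s, χ) > 0` for `s ∈ (0, 1)` for this character mod `163`."
[cite: Louboutin2013Chowla, p. 81]; "The challenges are (i) to computationally prove that `d_χ ≠ 0`,
and (ii) to find either `d_χ` or `D_χ`. We have not found any of these two invariants"
[cite: Louboutin2013Chowla, §7]; along the chain of the first inert primes Louboutin shows
`m(χ^{(D_9)}) = ∞`, "`t_χ ≥ 10` and `D_{10} = 6469693230` divides `D_χ`. Notice that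
`f := 163 D_{10} ≈ 10^{12}`" [cite: Louboutin2013Chowla, §7.2] (his bound concerns the least modulus
of the primorial chain at ANY order `m(χ) < ∞`; the present one concerns order `1` and ALL moduli).

## The mechanism: the Liouville block

All primes `p ≤ 37` are inert in `ℚ(√−163)` (Euler's `n² + n + 41`), so `χ_{−163}(n) = λ(n)`
(Liouville) for `n ≤ 40` — the tree's table `lamTable`, checked against the Legendre symbols by
`norm_num` (`chi163_eq_lamTable`). For `n ≤ 40`, `χ_{−163}↑m (n) = λ(n)` if no prime `p ≤ 37`
dividing `m` divides `n`, and `0` otherwise (`re_changeLevel_chi163`, `coprime_iff_kept`). So the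
forty numbers `S_1(N, χ_{−163}↑m)`, `N ≤ 40`, depend only on the set `D` of primes `p ≤ 37`
dividing `m`, and a finite check over the `2¹²` sets `D` (`test_allFlags`, by `decide`: the
Liouville sums sifted by the complement `K` of `D` stay `≥ 0` up to `40` only when `|K| ≤ 1` or
`K ∈ {{5,29}, {5,31}, {5,37}}` — by hand: with two kept primes `p₁ < p₂ ≤ 37` the kept integers
`≤ 40` begin `1, p₁, …` and the sum returns to `0` at `p₁` and goes negative at the next kept
prime unless a kept prime square intervenes, which below `40` happens only for `p₁ = 5 < 25 < p₂`)
shows that `163 · ∏_{p ∈ D} p ≥ 163 · 7420738134810/(5·37) = 6 538 271 978 238` whenever the forty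
sums are `≥ 0`; and `163 · ∏_{p ∈ D} p ∣ m`.

For comparison, Louboutin's analytic constraint (sibling `FeketePolyaPositivityHeilbronn.lean`,
`half_le_re_LFunction_one_mul_eulerFactors_of_induced`: `L(1, ψ) ∏_{p ∣ m}(1 − ψ(p)/p) ≥ 1/2`)
only forces `∏_{p ∣ m, p inert}(1 + 1/p) ≥ √163/(2π) = 2.03`, i.e. `2·3·5 ∣ m` or similar.
Removing further inert primes is necessary too: with `m = 163 · ∏_{p ∈ D} p` itself, each of the
sixteen surviving `D` first fails at some `N ≤ 139` (e.g. `D` = all twelve primes: `S_1(139) = −1`,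
from the inert primes `59, 67, 73, 79, 89, 101, 103, 107, 109, 127, 137, 139`); this is recorded
here only as a remark (the theorem uses the window `N ≤ 40`).

## References

* [Louboutin2013Chowla] S. Louboutin, *On the size of `L(1,χ)` and S. Chowla's hypothesis
  implying that `L(1,χ) > 0` for `s > 0` and for real characters `χ`*, Colloq. Math. 130 (2013),
  79–90 (read: p. 81, §6 Lemma 6.1–Prop. 6.2, §7 pp. 88–89).
* [Louboutin2003] S. R. Louboutin, Colloq. Math. 96 (2003), 207–212 (read).
* [MontgomeryVaughan2007] H. L. Montgomery, R. C. Vaughan, *Multiplicative Number Theory I*, CUP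
  2007, §11.2.1 Exercise 8.
* [ChowlaDeLeonHartung1973] S. Chowla, M. J. DeLeon, P. Hartung, J. reine angew. Math. 262/263
  (1973), 415–419; [Rosser1950RealRoots] J. B. Rosser, J. Res. Nat. Bur. Standards 45 (1950),
  505–514 (both cited through Louboutin 2013; not read).

## Design notes

* The finite check is organised for the KERNEL (`decide`, about one minute): flags are a
  `List Bool` aligned with `smallPrimes`, `kept`/`windowGo`/`prodFlags` are structural recursions,
  and `allFlags 12` enumerates the `4096` flag lists; `test_of_length` transports the check to the
  symbolic flag list `flags m = smallPrimes.map (p ↦ decide (p ∣ m))` of an arbitrary modulus.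
* `S_1` is the sibling files' `summatory (fun n ↦ (χ n).re)`, the induced character is Mathlib's
  `DirichletCharacter.changeLevel (163 ∣ m) chi163Char`; its values are `χ_{−163}(n)` on units
  (`changeLevel_eq_cast_of_dvd'`) and `0` on non-units (`ZMod.isUnit_iff_coprime`).
* No real analysis is involved; the file is elementary arithmetic plus the finite check.
-/

open Finset

namespace Literature.Barriers.RiemannHypothesis

namespace Chowla163

/-! ## The finite check (kernel `decide`) -/

/-- The twelve primes `≤ 37`, all inert in `ℚ(√−163)`. [folklore] -/
def smallPrimes : List ℕ := [2, 3, 5, 7, 11, 13, 17, 19, 23, 29, 31, 37]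

/-- `λ(1), …, λ(40)` (Liouville's function), `= χ_{−163}(n)` for `n ≤ 40` (`chi163_eq_lamTable`).
[folklore] -/
def lamTable : List ℤ :=
  [1, -1, -1, 1, -1, 1, -1, -1, 1, 1, -1, -1, -1, 1, 1, 1, -1, -1, -1, -1,
    1, 1, -1, 1, 1, 1, -1, -1, -1, -1, -1, -1, 1, 1, 1, 1, -1, 1, 1, 1]

/-- `kept ps bs n`: no prime `ps[i]` whose flag `bs[i]` is set divides `n` (for the flags of a
modulus `m`: `n` has no prime factor `p ∈ ps` dividing `m`). [folklore] -/
def kept : List ℕ → List Bool → ℕ → Bool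
  | p :: ps, b :: bs, n => (!(b && n % p == 0)) && kept ps bs n
  | _, _, _ => true

/-- Running check that the sifted partial sums `s + ∑ (kept ? ls[i] : 0)` stay `≥ 0`. [folklore] -/
def windowGo (bs : List Bool) : List ℤ → ℕ → ℤ → Bool
  | [], _, _ => true
  | l :: ls, n, s =>
    decide (0 ≤ s + if kept smallPrimes bs n then l else 0) &&
      windowGo bs ls (n + 1) (s + if kept smallPrimes bs n then l else 0)

/-- The window test: all forty sifted Liouville sums `∑_{n ≤ N, n kept} λ(n)`, `N ≤ 40`, are `≥ 0`.
[folklore] -/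
def windowOK (bs : List Bool) : Bool := windowGo bs lamTable 1 0

/-- Product of the flagged primes. [folklore] -/
def prodFlags : List ℕ → List Bool → ℕ
  | p :: ps, b :: bs => (if b then p else 1) * prodFlags ps bs
  | _, _ => 1

/-- The bound `163 · 7420738134810 / (5 · 37) = 6 538 271 978 238`. [folklore] -/
def bound : ℕ := 6538271978238

/-- The test decided for each flag list: if the window test passes then `163 · ∏(flagged) ≥ bound`.
[folklore] -/
def test (bs : List Bool) : Bool :=
  !windowOK bs || decide (bound ≤ 163 * prodFlags smallPrimes bs)

/-- All `Bool` lists of length `k`. [folklore] -/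
def allFlags : ℕ → List (List Bool)
  | 0 => [[]]
  | k + 1 => (allFlags k).flatMap fun bs ↦ [false :: bs, true :: bs]

set_option maxRecDepth 200000 in
set_option maxHeartbeats 40000000 in
/-- **The finite check**: `test` holds for all `4096` flag lists of length `12` (kernel `decide`;
the sixteen lists passing the window test are the complements of `∅`, the twelve singletons and
`{5,29}, {5,31}, {5,37}`). [folklore] -/
theorem test_allFlags : (allFlags 12).all test = true := by
  decide

/-- Every `Bool` list lies in `allFlags` of its length. [folklore] -/
theorem mem_allFlags : ∀ bs : List Bool, bs ∈ allFlags bs.length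
  | [] => by simp [allFlags]
  | b :: bs => by
    simp only [List.length_cons, allFlags, List.mem_flatMap]
    exact ⟨bs, mem_allFlags bs, by cases b <;> simp⟩

/-- The check, for an arbitrary flag list of length `12`. [folklore] -/
theorem test_of_length {bs : List Bool} (h : bs.length = 12) : test bs = true :=
  List.all_eq_true.1 test_allFlags bs (h ▸ mem_allFlags bs)

/-! ## Specifications of the recursions -/

/-- `kept` against the divisibility flags of `m`: `n` is kept iff no listed prime dividing `m`
divides `n`. [folklore] -/
theorem kept_map_iff (m n : ℕ) : ∀ ps : List ℕ,
    kept ps (ps.map fun p ↦ decide (p ∣ m)) n = true ↔ ∀ p ∈ ps, p ∣ m → ¬ p ∣ n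
  | [] => by simp [kept]
  | p :: ps => by
    rw [List.map_cons, kept, Bool.and_eq_true, kept_map_iff m n ps, List.forall_mem_cons,
      Nat.dvd_iff_mod_eq_zero (m := p) (n := n)]
    simp [imp_iff_not_or]

/-- A number coprime to every listed prime is coprime to `prodFlags`. [folklore] -/
theorem coprime_prodFlags (a : ℕ) : ∀ (ps : List ℕ) (bs : List Bool),
    (∀ q ∈ ps, Nat.Coprime a q) → Nat.Coprime a (prodFlags ps bs)
  | [], bs, _ => by cases bs <;> simp [prodFlags]
  | p :: ps, [], _ => by simp [prodFlags]
  | p :: ps, b :: bs, h => by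
    rw [prodFlags]
    refine Nat.Coprime.mul_right ?_ (coprime_prodFlags a ps bs fun q hq ↦ h q (by simp [hq]))
    cases b
    · simp
    · simpa using h p (by simp)

/-- The product of the flagged primes of `m` divides `m` (listed primes pairwise coprime). [folklore] -/
theorem prodFlags_map_dvd (m : ℕ) : ∀ ps : List ℕ, ps.Pairwise Nat.Coprime →
    prodFlags ps (ps.map fun p ↦ decide (p ∣ m)) ∣ m
  | [], _ => by simp [prodFlags]
  | p :: ps, h => by
    rw [List.pairwise_cons] at h
    rw [List.map_cons, prodFlags]
    have ih := prodFlags_map_dvd m ps h.2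
    by_cases hp : p ∣ m
    · have hcop : Nat.Coprime p (prodFlags ps (ps.map fun p ↦ decide (p ∣ m))) :=
        coprime_prodFlags p ps _ h.1
      simpa [hp] using Nat.Coprime.mul_dvd_of_dvd_of_dvd hcop hp ih
    · simpa [hp] using ih

/-- If all the sifted partial sums are `≥ 0` then the running check `windowGo` succeeds. [folklore] -/
theorem windowGo_of_sums (bs : List Bool) : ∀ (ls : List ℤ) (n : ℕ) (s : ℤ),
    (∀ j, 1 ≤ j → j ≤ ls.length →
      0 ≤ s + ∑ i ∈ range j, (if kept smallPrimes bs (n + i) then ls.getD i 0 else 0)) →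
    windowGo bs ls n s = true
  | [], _, _, _ => rfl
  | l :: ls, n, s, h => by
    rw [windowGo, Bool.and_eq_true, decide_eq_true_eq]
    have h1 := h 1 le_rfl (by simp only [List.length_cons]; omega)
    rw [Finset.sum_range_one, Nat.add_zero, List.getD_cons_zero] at h1
    refine ⟨h1, windowGo_of_sums bs ls (n + 1) _ fun j hj1 hj ↦ ?_⟩
    have hj' : j + 1 ≤ (l :: ls).length := by simp only [List.length_cons]; omega
    have h2 := h (j + 1) (by omega) hj'
    rw [Finset.sum_range_succ', Nat.add_zero, List.getD_cons_zero] at h2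
    have hterm : ∀ k ∈ range j,
        (if kept smallPrimes bs (n + (k + 1)) then (l :: ls).getD (k + 1) 0 else 0) =
          (if kept smallPrimes bs (n + 1 + k) then ls.getD k 0 else 0) := by
      intro k _
      rw [List.getD_cons_succ, Nat.add_right_comm, Nat.add_assoc]
    rw [Finset.sum_congr rfl hterm] at h2
    linarith

/-! ## From a modulus `m` to its flags -/

/-- The divisibility flags of `m` along `smallPrimes`. [folklore] -/
def flags (m : ℕ) : List Bool := smallPrimes.map fun p ↦ decide (p ∣ m)

/-- Primes `≤ 40` are among `smallPrimes`. [folklore] -/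
theorem mem_smallPrimes_of_prime_le {p : ℕ} (hp : p.Prime) (h : p ≤ 40) : p ∈ smallPrimes := by
  have key : ∀ q < 41, Nat.Prime q → q ∈ smallPrimes := by decide
  exact key p (by omega) hp

/-- For `1 ≤ n ≤ 40`: `n` is coprime to `m` iff no prime `p ≤ 37` dividing `m` divides `n`. [folklore] -/
theorem coprime_iff_kept {m n : ℕ} (hn1 : 1 ≤ n) (hn : n ≤ 40) :
    n.Coprime m ↔ kept smallPrimes (flags m) n = true := by
  rw [flags, kept_map_iff]
  constructor
  · intro hc p hp hpm hpn
    have hp2 : 2 ≤ p := by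
      have key : ∀ q ∈ smallPrimes, 2 ≤ q := by decide
      exact key p hp
    have h1 : p ∣ Nat.gcd n m := Nat.dvd_gcd hpn hpm
    rw [hc.gcd_eq_one] at h1
    have := Nat.le_of_dvd one_pos h1
    omega
  · intro h
    by_contra hc
    have hg : Nat.gcd n m ≠ 1 := hc
    have hp : (Nat.gcd n m).minFac.Prime := Nat.minFac_prime hg
    have hpn : (Nat.gcd n m).minFac ∣ n := (Nat.minFac_dvd _).trans (Nat.gcd_dvd_left n m)
    have hpm : (Nat.gcd n m).minFac ∣ m := (Nat.minFac_dvd _).trans (Nat.gcd_dvd_right n m)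
    have hple : (Nat.gcd n m).minFac ≤ 40 := (Nat.le_of_dvd (by omega) hpn).trans hn
    exact h _ (mem_smallPrimes_of_prime_le hp hple) hpm hpn

/-- `163 · ∏(primes ≤ 37 dividing m)` divides `m` when `163 ∣ m`. [folklore] -/
theorem mul_prodFlags_dvd {m : ℕ} (hm : 163 ∣ m) : 163 * prodFlags smallPrimes (flags m) ∣ m := by
  have hpw : smallPrimes.Pairwise Nat.Coprime := by decide
  have hcop : Nat.Coprime 163 (prodFlags smallPrimes (flags m)) :=
    coprime_prodFlags 163 smallPrimes _ (by decide)
  exact Nat.Coprime.mul_dvd_of_dvd_of_dvd hcop hm (prodFlags_map_dvd m smallPrimes hpw)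

/-! ## The induced character `χ_{−163}↑m` on `1 … 40` -/

/-- `χ_{−163}(n) = λ(n)` for `1 ≤ n ≤ 40` (the Legendre symbols `(n/163)` against the table;
all primes `≤ 37` are inert in `ℚ(√−163)`). [folklore] -/
theorem chi163_eq_lamTable (n : ℕ) (hn1 : 1 ≤ n) (hn : n ≤ 40) :
    chi163 n = ((lamTable.getD (n - 1) 0 : ℤ) : ℝ) := by
  interval_cases n <;> (simp only [chi163, lamTable]; norm_num)

/-- Values of the induced character: `Re χ_{−163}↑m (n) = χ_{−163}(n)` if `gcd(n, m) = 1`, else `0`.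
[folklore] -/
theorem re_changeLevel_chi163 {m : ℕ} [NeZero m] (hm : 163 ∣ m) (n : ℕ) :
    (DirichletCharacter.changeLevel hm chi163Char (n : ZMod m)).re =
      if n.Coprime m then chi163 n else 0 := by
  split_ifs with h
  · have hc : IsCoprime (n : ℤ) (m : ℤ) := Nat.isCoprime_iff_coprime.2 h
    have key := DirichletCharacter.changeLevel_eq_cast_of_dvd' chi163Char hm hc
    rw [Int.cast_natCast, Int.cast_natCast] at key
    rw [key, chi163Char_re]
  · have hu : ¬ IsUnit ((n : ℕ) : ZMod m) := by rwa [ZMod.isUnit_iff_coprime]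
    rw [MulChar.map_nonunit _ hu, Complex.zero_re]

/-- For `N ≤ 40`, `S_1(N, χ_{−163}↑m)` is the sifted Liouville sum computed by the finite check on
the flags of `m`. [folklore] -/
theorem summatory_re_changeLevel_chi163_eq {m : ℕ} [NeZero m] (hm : 163 ∣ m) (N : ℕ)
    (hN : N ≤ 40) :
    summatory (fun n ↦ (DirichletCharacter.changeLevel hm chi163Char (n : ZMod m)).re) N =
      ((∑ i ∈ range N,
        (if kept smallPrimes (flags m) (1 + i) then lamTable.getD i 0 else 0) : ℤ) : ℝ) := by
  induction N with
  | zero => simp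
  | succ N ih =>
    rw [summatory_succ, ih (by omega), Finset.sum_range_succ, Int.cast_add,
      re_changeLevel_chi163 hm, show 1 + N = N + 1 by omega]
    congr 1
    by_cases hk : kept smallPrimes (flags m) (N + 1) = true
    · have hc : (N + 1).Coprime m := (coprime_iff_kept (by omega) (by omega)).2 hk
      rw [if_pos hc, if_pos hk, chi163_eq_lamTable (N + 1) (by omega) (by omega),
        Nat.add_sub_cancel]
    · have hc : ¬ (N + 1).Coprime m := fun h' ↦ hk ((coprime_iff_kept (by omega) (by omega)).1 h')
      rw [if_neg hc, if_neg hk, Int.cast_zero]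

end Chowla163

open Chowla163

/-! ## The bound on Chowla's inducing modulus at `d = −163` -/

/-- **An order-one Chowla modulus for `χ_{−163}` is at least `6.5 · 10¹²`.** If `163 ∣ m` and the
induced character `χ_{−163}↑m` has `S_1(N, χ_{−163}↑m) = ∑_{n ≤ N, (n,m)=1} (n/163) ≥ 0` for all
`N ≥ 1`, then `m ≥ 6 538 271 978 238`. Reason: `χ_{−163} = λ` on `1 … 40`; the forty sums
`S_1(N)`, `N ≤ 40`, are sifted Liouville sums depending only on which primes `p ≤ 37` divide `m`,
and they stay `≥ 0` only if at least ten of the twelve do, with `163 ∏_{p ≤ 37, p ∣ m} p ≥`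
`163 · 7420738134810/(5·37)` in every surviving case (`test_allFlags`). Compare "`D_{10} =
6469693230` divides `D_χ`. Notice that `f := 163 D_{10} ≈ 10^{12}`" for the primorial chain at any
order [cite: Louboutin2013Chowla, §7.2]; the induced-character hypothesis at `163` is unverified
[cite: Louboutin2013Chowla, p. 81]. -/
theorem chowla_inducing_modulus_chi163 {m : ℕ} [NeZero m] (hm : 163 ∣ m)
    (hS : ∀ N : ℕ, 1 ≤ N →
      0 ≤ summatory (fun n ↦ (DirichletCharacter.changeLevel hm chi163Char (n : ZMod m)).re) N) :
    6538271978238 ≤ m := by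
  have hlen : (flags m).length = 12 := by simp [flags, smallPrimes]
  have hsum : ∀ j, 1 ≤ j → j ≤ lamTable.length →
      0 ≤ (0 : ℤ) + ∑ i ∈ range j,
        (if kept smallPrimes (flags m) (1 + i) then lamTable.getD i 0 else 0) := by
    intro j hj1 hj
    have hj40 : j ≤ 40 := by simpa [lamTable] using hj
    have h := hS j hj1
    rw [summatory_re_changeLevel_chi163_eq hm j hj40] at h
    rw [zero_add]
    exact_mod_cast h
  have hw : windowOK (flags m) = true := windowGo_of_sums _ lamTable 1 0 hsum
  have ht := test_of_length hlen
  rw [test, hw] at ht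
  simp only [Bool.not_true, Bool.false_or, decide_eq_true_eq, bound] at ht
  exact ht.trans (Nat.le_of_dvd (Nat.pos_of_ne_zero (NeZero.ne m)) (mul_prodFlags_dvd hm))

/-! ## Consequence for `ChowlaInducedCharacterConjectureOdd` -/

/-- `χ_{−163}` is primitive (conductor `163`: a non-principal character to a prime modulus).
[folklore] -/
theorem chi163Char_isPrimitive : chi163Char.IsPrimitive := by
  rw [DirichletCharacter.isPrimitive_def]
  rcases (Nat.dvd_prime fact_prime_163.out).1 chi163Char.conductor_dvd_level with h' | h'
  · exact absurd (DirichletCharacter.eq_one_iff_conductor_eq_one.2 h') chi163Char_ne_one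
  · exact h'

/-- `χ_{−163}` is odd: `(−1/163) = −1` (`163 ≡ 3 mod 4`). [folklore] -/
theorem chi163Char_odd : chi163Char.Odd := by
  rw [DirichletCharacter.Odd, show (-1 : ZMod 163) = ((162 : ℕ) : ZMod 163) by decide,
    chi163Char_apply_natCast, chi163]
  norm_num

/-- **What Chowla's conjecture must deliver at `d = −163`.** Under
`ChowlaInducedCharacterConjectureOdd` the induced character it provides for `ψ = χ_{−163}` —
some `χ_{−163}↑m`, `163 ∣ m`, with `S_1(N, χ_{−163}↑m) ≥ 0` for all `N ≥ 1` — has modulus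
`m ≥ 6 538 271 978 238`: the evasion catalogued under `FeketePolyaPositivity` is, at the barrier's
own witness, a claim about partial sums of period `> 10^{13}`, open and numerically unexplored
("We have not found any of these two invariants"). [cite: Louboutin2013Chowla, §7] -/
theorem chowlaOdd_witness_chi163_ge (h : ChowlaInducedCharacterConjectureOdd) :
    ∃ (m : ℕ) (hm : 163 ∣ m), 6538271978238 ≤ m ∧
      ∀ N : ℕ, 1 ≤ N → 0 ≤ iterSummatory
        (fun n ↦ (DirichletCharacter.changeLevel hm chi163Char (n : ZMod m)).re) 1 N := by
  obtain ⟨m, hm, hm0, hS⟩ :=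
    h 163 chi163Char chi163Char_isPrimitive chi163Char_ne_one chi163Char_isQuadratic chi163Char_odd
  haveI : NeZero m := ⟨hm0⟩
  exact ⟨m, hm, chowla_inducing_modulus_chi163 hm (by simpa [iterSummatory_succ] using hS), hS⟩

end Literature.Barriers.RiemannHypothesis
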